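import Summits.ValiantsHypothesis.ValiantsHypothesis.Theorems.LacunarySymmetroidMatrixDescartesDoorA26WallBubblingConfluentLimit

/-!
# Wall bubbling for `DoorA26` — ONE WEYL PAIR, any face point: the confluent limit of a cluster WITHOUT the 2-Sidon hypothesis

LINE / STUBS.  Crux `Theses.LacunarySymmetroid.DoorA26` (stmt-ValiantsHypothesis-19979; OPEN, typed, never asserted), line
`Cruxes/DoorA26/Lines/wall_bubbling.lean` (val-idea-15), obligation (W) `Stmt.stub_weylFaces`; statement file
`Cruxes/DoorA26/Lines/wall_bubbling_ConfluentDoor.lean` rev 4, stratum `Stmt.weylFaces_wall` with ONE Weyl pair (cases (a) `e_k + e_l = e_m + e_n` among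
the four non-Weyl values, (b) `e₀ + e_k = e_l + e_m` through the Weyl value; W1 #14 itemisation).  Seat val-sym-door-p2 g13 (W1 #34).

W2's `…ConfluentLimit.confluentLimit` (door-p1 g14) bundles the GENERIC-face non-degeneracy (`hsid`, 2-Sidon values) into the limit theorem.  On the wall
strata the values are NOT 2-Sidon, and non-degeneracy is a separate inertia statement (W1 #35, as for two pairs in W1 #26).  This file is the limit
theorem WITHOUT `hsid` (def-free, same frame `frame_det`, same Gram normalisation):

* `onePairLimit` — for ANY sequence of genuine `(2,6)` pencils whose exponents converge to a point with `δ0 5 = δ0 0` (no hypothesis on the five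
  values), along a subsequence and after scalar normalisation: C^∞ convergence to the confluent determinant
  `det(e^{δ₀t}(W₀ + tW₅) + Σ_k e^{δ_{k+1}t}W_{k+1})` of a SYMMETRIC frame `W` with SOME non-zero polar Gram entry.

Nothing in this file bears on (W)/(M)/(R) themselves, on `DoorA26`, on `MatrixDescartes` (stmt-ValiantsHypothesis-18050) or on `VP ≠ VNP`;
registers unchanged.  `--supports stmt-ValiantsHypothesis-19979 --as helper`.  [this work] bookkeeping over W2's `…ConfluentLimit`.
-/

-- `Summit.ValiantsHypothesis.ValiantsHypothesis.…` repeats a component by the D-0017 layout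
-- (single-conjunct summit), which the `dupNamespace` linter flags; the name is mandated.
set_option linter.dupNamespace false

namespace Summit.ValiantsHypothesis.ValiantsHypothesis.Theorems.LacunarySymmetroidMatrixDescartes.WallBubbling

open Finset Filter Topology Polynomial
open Bubbling (polar Realisable polar_comm polar_self det_sum_smul_fin_two realisable_polarGram realisable_smul realisable_of_tendsto)
open scoped BigOperators

/-- **THE CONFLUENT LIMIT OF A CLUSTER, ONE WEYL PAIR, NO 2-SIDON HYPOTHESIS.**  Positions: the pair at `0, 5` (`δ^ν₀, δ^ν₅ → δ0 0 = δ0 5`), the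
other four letters at `k.succ.castSucc`.  Output: a subsequence `φ`, scalars `a`, a SYMMETRIC limit frame `W` with a non-zero polar Gram entry, and
continuous convergence with all derivatives to the confluent determinant of `W`. [this work] -/
theorem onePairLimit (δs : ℕ → Fin 6 → ℝ) (δ0 : Fin 6 → ℝ)
    (hδ : ∀ l, Tendsto (fun ν => δs ν l) atTop (𝓝 (δ0 l))) (h05 : δ0 5 = δ0 0)
    (U : ℕ → Fin 6 → Matrix (Fin 2) (Fin 2) ℝ) (hU : ∀ ν l, (U ν l).IsSymm)
    (hne : ∀ ν, ∃ t, (∑ l, Real.exp (δs ν l * t) • U ν l).det ≠ 0) :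
    ∃ φ : ℕ → ℕ, StrictMono φ ∧
    ∃ (a : ℕ → ℝ) (W : Fin 6 → Matrix (Fin 2) (Fin 2) ℝ),
      (∀ l, (W l).IsSymm) ∧ (∃ p q, polar (W p) (W q) ≠ 0) ∧
      ∀ (n : ℕ) (ψ : ℕ → ℕ), StrictMono ψ → ∀ (ts : ℕ → ℝ) (t₀ : ℝ), Tendsto ts atTop (𝓝 t₀) →
        Tendsto (fun k => iteratedDeriv n (fun t => a (ψ k) * (∑ l, Real.exp (δs (φ (ψ k)) l * t) • U (φ (ψ k)) l).det) (ts k))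
          atTop (𝓝 (iteratedDeriv n
            (fun t => ((Real.exp (δ0 0 * t)) • (W 0 + t • W 5) + ∑ k : Fin 4, (Real.exp (δ0 k.succ.castSucc * t)) • W k.succ.castSucc).det) t₀)) := by
  classical
  set V : ℕ → Fin 6 → Matrix (Fin 2) (Fin 2) ℝ := fun ν l =>
    if l = 0 then U ν 0 + U ν 5 else if l = 5 then (δs ν 5 - δs ν 0) • U ν 5 else U ν l with hV
  set M : ℕ → Fin 6 × Fin 6 → ℝ := fun ν pq => polar (V ν pq.1) (V ν pq.2) with hM
  set μ : ℕ → ℝ := fun ν => (univ : Finset (Fin 6 × Fin 6)).sup' (Finset.univ_nonempty) (fun pq => |M ν pq|) with hμ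
  have hdom : ∀ ν pq, |M ν pq| ≤ μ ν := fun ν pq => Finset.le_sup' (fun pq => |M ν pq|) (Finset.mem_univ pq)
  have hatt : ∀ ν, ∃ pq, |M ν pq| = μ ν := by
    intro ν
    obtain ⟨pq, _, hpq⟩ := Finset.exists_mem_eq_sup' (Finset.univ_nonempty (α := Fin 6 × Fin 6)) (fun pq => |M ν pq|)
    exact ⟨pq, hpq.symm⟩
  set c : ℕ → Fin 6 → ℝ → ℝ := fun ν p t =>
    if p = 5 then dslope (fun y : ℝ => Real.exp (y * t)) (δs ν 0) (δs ν 5) else Real.exp (δs ν p * t) with hc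
  set c₀ : Fin 6 → ℝ → ℝ := fun p t =>
    if p = 5 then dslope (fun y : ℝ => Real.exp (y * t)) (δ0 0) (δ0 0) else Real.exp (δ0 p * t) with hc₀
  have hframe : ∀ ν t, (∑ l, Real.exp (δs ν l * t) • U ν l).det = ∑ p, ∑ q, M ν (p, q) * (c ν p t * c ν q t) := by
    intro ν t
    rw [frame_det]
  have hμpos : ∀ ν, 0 < μ ν := by
    intro ν
    obtain ⟨t, ht⟩ := hne ν
    rw [hframe ν t] at ht
    obtain ⟨p, _, hp⟩ := Finset.exists_ne_zero_of_sum_ne_zero ht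
    obtain ⟨q, _, hq⟩ := Finset.exists_ne_zero_of_sum_ne_zero hp
    have hM0 : M ν (p, q) ≠ 0 := fun h => hq (by rw [h, zero_mul])
    exact lt_of_lt_of_le (abs_pos.mpr hM0) (hdom ν (p, q))
  obtain ⟨φ, hφ, cl, hcl, -, hcl1⟩ := levelSelection_multi M μ hμpos hdom hatt
  have hreal : Realisable (Matrix.of fun p q => cl (p, q)) := by
    refine realisable_of_tendsto (Gseq := fun k => (μ (φ k))⁻¹ • Matrix.of fun p q => M (φ k) (p, q)) ?_ ?_
    · intro k
      exact realisable_smul _ (realisable_polarGram (V (φ k)) (fun l => frame_isSymm (δs (φ k)) (U (φ k)) (hU (φ k)) l))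
    · refine tendsto_pi_nhds.mpr fun p => tendsto_pi_nhds.mpr fun q => ?_
      have := hcl (p, q)
      simp only [Matrix.smul_apply, Matrix.of_apply, smul_eq_mul]
      simpa [div_eq_inv_mul] using this
  obtain ⟨ε, W, hε, hW, hGW⟩ := hreal
  have hε2 : ε * ε = 1 := by rcases hε with rfl | rfl <;> norm_num
  have hcW : ∀ p q, ε * cl (p, q) = polar (W p) (W q) := by
    intro p q
    have := hGW p q
    simp only [Matrix.of_apply] at this
    rw [this, ← mul_assoc, hε2, one_mul]
  have hWne : ∃ p q, polar (W p) (W q) ≠ 0 := by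
    obtain ⟨⟨p, q⟩, hpq⟩ := hcl1
    refine ⟨p, q, ?_⟩
    rw [← hcW]
    intro h
    rcases mul_eq_zero.mp h with h1 | h1
    · rcases hε with rfl | rfl <;> norm_num at h1
    · rw [h1, abs_zero] at hpq; norm_num at hpq
  refine ⟨φ, hφ, fun k => ε * (μ (φ k))⁻¹, W, hW, hWne, ?_⟩
  intro n ψ hψ ts t₀ hts
  have hφψ : Tendsto (fun k => φ (ψ k)) atTop atTop := hφ.tendsto_atTop.comp hψ.tendsto_atTop
  have happrox : ∀ k, (fun t => ε * (μ (φ (ψ k)))⁻¹ * (∑ l, Real.exp (δs (φ (ψ k)) l * t) • U (φ (ψ k)) l).det)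
      = fun t => ∑ p, ∑ q, (ε * (M (φ (ψ k)) (p, q) / μ (φ (ψ k)))) * (c (φ (ψ k)) p t * c (φ (ψ k)) q t) := by
    intro k; funext t
    rw [hframe, Finset.mul_sum]
    refine Finset.sum_congr rfl fun p _ => ?_
    rw [Finset.mul_sum]
    refine Finset.sum_congr rfl fun q _ => ?_
    rw [div_eq_mul_inv]; ring
  have hlimit : (fun t => ((Real.exp (δ0 0 * t)) • (W 0 + t • W 5) + ∑ k : Fin 4, (Real.exp (δ0 k.succ.castSucc * t)) • W k.succ.castSucc).det)
      = fun t => ∑ p, ∑ q, polar (W p) (W q) * (c₀ p t * c₀ q t) := by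
    funext t; exact confluentDet_eq_quadForm δ0 W t
  rw [hlimit]
  simp only [happrox]
  refine tendsto_iteratedDeriv_quadForm (ι := Fin 6)
    (fun k p q => ε * (M (φ (ψ k)) (p, q) / μ (φ (ψ k)))) (fun p q => polar (W p) (W q))
    (fun k p t => c (φ (ψ k)) p t) (fun p t => c₀ p t) ?_ ?_ ts t₀ ?_ ?_ n
  · intro k p m
    by_cases hp5 : p = 5
    · simp only [hc, hp5, if_true]; exact contDiff_dslope_exp _ _ m
    · simp only [hc, hp5, if_false]; exact contDiff_exp_const_mul' _ m
  · intro p m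
    by_cases hp5 : p = 5
    · simp only [hc₀, hp5, if_true]; exact contDiff_dslope_exp _ _ m
    · simp only [hc₀, hp5, if_false]; exact contDiff_exp_const_mul' _ m
  · intro p q
    rw [← hcW p q]
    exact ((hcl (p, q)).comp hψ.tendsto_atTop).const_mul ε
  · intro p i
    by_cases hp5 : p = 5
    · simp only [hc, hc₀, hp5, if_true]
      exact tendsto_iteratedDeriv_dslope_exp i ((hδ 0).comp hφψ) (by rw [← h05]; exact (hδ 5).comp hφψ) hts
    · simp only [hc, hc₀, hp5, if_false]
      exact tendsto_iteratedDeriv_exp i ((hδ p).comp hφψ) hts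

end Summit.ValiantsHypothesis.ValiantsHypothesis.Theorems.LacunarySymmetroidMatrixDescartes.WallBubbling
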